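import Summits.QuantumFields.YangMills.Theorems.PencilRigidityDiagonalMirrorRPRStubRpClosureOffDiag

/-!
# Crux `DiagonalMirrorRPR` (stmt-QuantumFields-10604), line `kms-variance-lukewarm-descent`: vocabulary of the
# second-moment lever (mirror covariance, lukewarm floors, the `e₁`-doubled torus)

Routes `PencilRigidity` / `MirrorModularBoosts` of `YangMills`, crux `DiagonalMirrorRPR`
(`Summit.QuantumFields.YangMills.Theses.MirrorModularBoosts.DiagonalMirrorRPR`, shared verbatim with the `PencilRigidity`
copy).  This module is the VOCABULARY ROOT of the registered skeleton
`Cruxes/DiagonalMirrorRPR/Lines/kms_variance_lukewarm_descent.lean` (§1 there, VERBATIM, same namespace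
`…KmsVarianceLukewarmDescent`, so that the registered stub signatures `stub_mirrorClustering`, `stub_schemeLukewarm`,
`stub_secondMomentLever` (= `DoublingStep ∧ TwistStep`) elaborate unchanged against it):

* `mirrorFamily μ d f`, `mirrorCov S₁ f μ d`, `MirrorClustering S₁` — the `e_μ`-mirror copy of a real family at
  displacement `d`, the continuum mirror covariance of the curvature string, and its clustering as `d → ∞` for
  `μ ∈ {0,1}` on pairwise-disjoint compact real families (the W₁-side input of the variance lever);
* `purity ρ β N = Z(N,2N,N)/Z(N,N,N)²`, `twistWeight ρ β N = Z(T̃_N)/Z(T''_N)` (ratios of the landed box-torus partition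
  functions `tZ`), the floors `PurityFloor`, `TwistWeightFloor` along a scheme and `SchemeLukewarm` = both;
* `dblProj`, `dblLift`, `doubledSchwinger`, `DoubledInsensitivityOffDiag` — the `e₁`-doubled torus
  `T''_N = ℤ⁴/⟨Ne₀, 2Ne₁, Ne₂, Ne₃⟩` (the unsheared box `(N, 2N, N)`), the curvature strings computed on it, and the
  intermediate station of the transport `T_N → T''_N → T̃_N`.

All over landed declarations (`tZ`, `texp`, `TConfig`, `latticeSchwinger`, `smearedLatticeField`, `translateTest`,
`linActTest`, `RpClosure.signFlip`, `RpClosure.ee`, `CoverInsensitivityOffDiag`).  References: M. Lüscher, Comm. Math.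
Phys. 54 (1977) 283; K. Osterwalder, E. Seiler, Ann. Phys. 110 (1978) 440, §2; J. Fröhlich, R. Israel, E. Lieb,
B. Simon, J. Stat. Phys. 22 (1980) 297, §3.
-/

set_option autoImplicit false

noncomputable section

open scoped SchwartzMap ComplexConjugate
open MeasureTheory Filter Topology
open Literature.MathematicalPhysics.QuantumLattice Literature.MathematicalPhysics.AQFT
  Literature.MathematicalPhysics.QuantumFieldTheory
open Summit.QuantumFields.YangMills.Cruxes.DiagonalMirrorRPR.ParityBridgeColdTraces
open Summit.QuantumFields.YangMills.Cruxes.DiagonalMirrorRPR.ParityBridgeColdTraces.RpClosure (signFlip ee)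

namespace Summit.QuantumFields.YangMills.Cruxes.DiagonalMirrorRPR.KmsVarianceLukewarmDescent

/-! ## §1 Vocabulary of the line (over landed declarations only: `CurvaturePackage`, `DiagonalFrameRP`, `E4`, the
box tori `TSite/TConfig/tZ/texp`, the cover `skewLift/coverSchwinger` from `…StubRpClosureDefs`;
`CoverInsensitivityOffDiag` from `…StubRpClosureOffDiag`; `signFlip`, `ee` from `…Defs` (`RpClosure`)) -/

section Mirror

/-- The `e_μ`-MIRROR COPY of a real family at displacement `d`: every test function reflected in the hyperplane
`x_μ = 0` and translated by `d e_μ` (`(mirrorFamily μ d f) i (x) = f i (σ_μ (x − d e_μ))`, `σ_μ` the sign flip of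
coordinate `μ`).  For `μ = 0` this is the OS adjoint partner of `HasMassGap`/E4 (real `f`: no conjugation; the order
of factors is immaterial by E3); it is also exactly the mirror-conjugate partner in the two-point trace
`Tr(𝕋^{N−n} 𝒳† 𝕋ⁿ 𝒳)` of the variance inequality. -/
def mirrorFamily {n : ℕ} (μ : Fin 4) (d : ℝ) (f : Fin n → 𝓢(E4, ℝ)) : Fin n → 𝓢(E4, ℝ) :=
  fun i => translateTest (d • ee μ) (linActTest (signFlip {μ}) (f i))

/-- The continuum MIRROR COVARIANCE of the curvature string `f` along `e_μ` at displacement `d`: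
`S₁(mirror ⊗ f) − S₁(mirror) · S₁(f)` on the canonical tensors. -/
def mirrorCov (S₁ : SchwingerFamily E4) {n : ℕ} (f : Fin n → 𝓢(E4, ℝ)) (μ : Fin 4) (d : ℝ) : ℂ :=
  S₁ (n + n) (SchwartzMap.tensorFin (n + n) fun i => ofRealTest (Fin.append (mirrorFamily μ d f) f i)) -
    S₁ n (SchwartzMap.tensorFin n fun i => ofRealTest (mirrorFamily μ d f i)) *
      S₁ n (SchwartzMap.tensorFin n fun i => ofRealTest (f i))

/-- **Mirror clustering of the limit along `e₀` and `e₁`** (the W₁-side input of the variance lever): for every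
non-empty compactly supported real family with pairwise disjoint supports, the mirror covariance tends to `0` as the
mirror copy recedes along `e₀` or `e₁`.  For families whose supports lie in pairwise disjoint `x_μ`-slabs this is
E4/`HasMassGap` of `S₁` (+ E3 to order the factors, + the proper signed permutation `(e₀,e₁) ↦ (e₁,−e₀)` of `W₁` for
`μ = 1`); for families with overlapping `x_μ`-projections it is the extra clause (R0') of the merged card
(`thermal-variance-transfer`: "OffDiagonalMirrorClustering"), not supplied by the `e₀`-based clauses of `W₁`
(Disproof §8 blind spot) and implied by any off-coincidence kernel regularity of `S₁`. -/
def MirrorClustering (S₁ : SchwingerFamily E4) : Prop :=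
  ∀ μ : Fin 4, (μ = 0 ∨ μ = 1) → ∀ (n : ℕ), n ≠ 0 → ∀ (f : Fin n → 𝓢(E4, ℝ)),
    (∀ i, HasCompactSupport (f i)) →
      (∀ i j, i ≠ j → Disjoint (tsupport (f i : E4 → ℝ)) (tsupport (f j : E4 → ℝ))) →
        Tendsto (fun d : ℝ => mirrorCov S₁ f μ d) atTop (𝓝 0)

end Mirror

section Lukewarm

variable {G : Type} [Group G] [TopologicalSpace G] [IsTopologicalGroup G] [CompactSpace G]
  [MeasurableSpace G] [BorelSpace G] {Nc : ℕ}

/-- **Purity of the `e₁`-thermal state of the box torus `ℤ_N⁴` at coupling `β`**: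
`Z(ℤ_N × ℤ_{2N} × ℤ_N²) / Z(ℤ_N⁴)²` (`= Tr 𝕋₁²ᴺ / (Tr 𝕋₁ᴺ)² = ∑ᵢ pᵢ² ∈ (0, 1]`, `pᵢ = λᵢᴺ/Z` the thermal law of the
`e₁`-transfer matrix `𝕋₁` on the slice `ℤ_N³`; `= 1` at `β = 0`).  Stated with partition functions only. -/
def purity (ρ : G →* Matrix (Fin Nc) (Fin Nc) ℂ) (β : ℝ) (N : ℕ) [NeZero N] : ℝ :=
  tZ ρ N (2 * N) N β false / tZ ρ N N N β false ^ 2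

/-- **Twist weight** `Z(T̃_N) / Z(T''_N)`: the 45° cover `ℤ⁴/⟨N(e₀ ± e₁), Ne₂, Ne₃⟩` (sheared box `(2N, N, N)`) over
the `e₁`-doubled torus `ℤ⁴/⟨Ne₀, 2Ne₁, Ne₂, Ne₃⟩` (box `(N, 2N, N)`) — both have `2N⁴` sites; slicing along `e₀`,
`Z(T''_N) = Tr 𝔹ᴺ` and `Z(T̃_N) = Tr 𝔹ᴺ U_{Ne₁}` (`𝔹` the `e₀`-transfer matrix of the doubled slice `ℤ_{2N} × ℤ_N²`,
`U` the half-turn, `[U, 𝔹] = 0`, `U² = 1`), so the ratio is `⟨U_{Ne₁}⟩_{T''} ∈ (0, 1]` (`= 1` at `β = 0`). -/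
def twistWeight (ρ : G →* Matrix (Fin Nc) (Fin Nc) ℂ) (β : ℝ) (N : ℕ) [NeZero N] : ℝ :=
  tZ ρ (2 * N) N N β true / tZ ρ N (2 * N) N β false

/-- **Purity floor along the scheme**: `purity(β_k, N_k) ≥ c > 0` for all large `k` (`N_k = sch.side k = 2L_k+1`). -/
def PurityFloor {ι : Type} (ρ : G →* Matrix (Fin Nc) (Fin Nc) ℂ) (sch : SpeciesScheme ι) : Prop :=
  ∃ c : ℝ, 0 < c ∧ ∀ᶠ k in atTop, c ≤ purity ρ (sch.β k) (sch.side k)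

/-- **Twist-weight floor along the scheme**: `Z(T̃_{N_k}) / Z(T''_{N_k}) ≥ c > 0` for all large `k`. -/
def TwistWeightFloor {ι : Type} (ρ : G →* Matrix (Fin Nc) (Fin Nc) ℂ) (sch : SpeciesScheme ι) : Prop :=
  ∃ c : ℝ, 0 < c ∧ ∀ᶠ k in atTop, c ≤ twistWeight ρ (sch.β k) (sch.side k)

/-- **Scheme lukewarmness** = both floors (an `O(1)` condition; round-1's coldness `ζ_k → 0` is the `o(1)` condition
purity `→ 1`, twist weight `→ 1`; a finite flat band of locally indistinguishable light sectors — e.g. the `|π₁(G)|³`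
't Hooft flux sectors that killed coldness — is lukewarm: purity `→ 1/q`, twist weight `→ 1`). -/
def SchemeLukewarm {ι : Type} (ρ : G →* Matrix (Fin Nc) (Fin Nc) ℂ) (sch : SpeciesScheme ι) : Prop :=
  PurityFloor ρ sch ∧ TwistWeightFloor ρ sch

end Lukewarm

/-! ### Non-vacuity of the floors: at `β = 0` purity and twist weight equal `1` (registered sub-goal
`stub_lukewarm_at_zero` of `stub_schemeLukewarm`) -/

section Zero

variable {G : Type} [Group G] [TopologicalSpace G] [IsTopologicalGroup G] [CompactSpace G]
  [MeasurableSpace G] [BorelSpace G] {Nc : ℕ}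

/-- Normalised Haar measure is a probability measure. -/
theorem isProbabilityMeasure_haarProbability' : IsProbabilityMeasure (haarProbability G) := by
  -- adapted from `isProbabilityMeasure_haarProbability` (Cruxes/TunedSequenceExists/Disproof)
  refine ⟨?_⟩
  show Measure.haarMeasure ⊤ Set.univ = 1
  rw [← TopologicalSpace.PositiveCompacts.coe_top]
  exact Measure.haarMeasure_self

/-- At `β = 0` every box-torus partition function is `1` (the weight is `exp 0 = 1` under product Haar measure). -/
theorem tZ_zero (ρ : G →* Matrix (Fin Nc) (Fin Nc) ℂ) (n₀ n₁ N : ℕ) [NeZero n₀] [NeZero n₁] [NeZero N]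
    (shear : Bool) : tZ ρ n₀ n₁ N 0 shear (G := G) = 1 := by
  haveI : IsProbabilityMeasure (haarProbability G) := isProbabilityMeasure_haarProbability'
  haveI : IsProbabilityMeasure (thaar n₀ n₁ N : Measure (TConfig n₀ n₁ N G)) := by
    unfold thaar; infer_instance
  simp [tZ, tweight]

/-- **Registered sub-goal `stub_lukewarm_at_zero` (non-vacuity of `SchemeLukewarm`).**  At `β = 0` the purity
`Z(N,2N,N)/Z(N,N,N)²` and the twist weight `Z(T̃_N)/Z(T''_N)` both equal `1`. -/
theorem stub_lukewarm_at_zero :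
    ∀ {G : Type} [Group G] [TopologicalSpace G] [IsTopologicalGroup G] [CompactSpace G]
      [MeasurableSpace G] [BorelSpace G] {Nc : ℕ} (ρ : G →* Matrix (Fin Nc) (Fin Nc) ℂ) (N : ℕ) [NeZero N],
      purity ρ 0 N = 1 ∧ twistWeight ρ 0 N = 1 := by
  intro G _ _ _ _ _ _ Nc ρ N _
  simp [purity, twistWeight, tZ_zero]

end Zero


section Doubled

variable {G : Type} [Group G] [TopologicalSpace G] [IsTopologicalGroup G] [CompactSpace G]
  [MeasurableSpace G] [BorelSpace G]

/-- Reduction of `ℤ⁴` modulo `⟨Ne₀, 2Ne₁, Ne₂, Ne₃⟩` onto the sites of the unsheared box torus `(N, 2N, N)`. -/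
def dblProj (N : ℕ) (x : Fin 4 → ℤ) : TSite N (2 * N) N :=
  (((x 0 : ℤ) : ZMod N), ((x 1 : ℤ) : ZMod (2 * N)), ((x 2 : ℤ) : ZMod N), ((x 3 : ℤ) : ZMod N))

/-- The `⟨Ne₀, 2Ne₁, Ne₂, Ne₃⟩`-periodic lift of a doubled-torus configuration to `ℤ⁴` (analogue of `skewLift`). -/
def dblLift (N : ℕ) (U : TConfig N (2 * N) N G) : LGConfig 4 G := fun e => U (dblProj N e.1, e.2)

/-- The curvature-string `n`-point function at step `k` computed on the `e₁`-DOUBLED torus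
`T''_{N_k} = ℤ⁴/⟨N_ke₀, 2N_ke₁, N_ke₂, N_ke₃⟩` with the scheme's spacing, coupling and renormalisations (same smearing
box `[-L_k, L_k]⁴ ⊂ ℤ⁴`, which embeds in `T''_{N_k}`). -/
def doubledSchwinger (r : LatticeRep G) (sch : SpeciesScheme (YMSpecies G)) (k n : ℕ)
    (f : Fin n → 𝓢(E4, ℝ)) : ℝ :=
  (texp r.ρ (sch.β k) false fun U : TConfig (sch.side k) (2 * sch.side k) (sch.side k) G =>
    ((∏ i, smearedLatticeField r.curvature.F (Literature.Probability.LatticeModels.box 4 (sch.L k))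
        (sch.a k) (sch.c r.curvature k) (sch.m r.curvature k) (f i) (dblLift (sch.side k) U) : ℝ) : ℂ)).re

/-- **Doubled-torus insensitivity on off-diagonal families**: for compactly supported real families with pairwise
disjoint supports, the curvature strings on the statement's torus `ℤ⁴/N_kℤ⁴` and on its `e₁`-doubled torus have
difference `→ 0` (the intermediate station of the transport). -/
def DoubledInsensitivityOffDiag (r : LatticeRep G) (sch : SpeciesScheme (YMSpecies G)) : Prop :=
  ∀ (n : ℕ), n ≠ 0 → ∀ (f : Fin n → 𝓢(E4, ℝ)), (∀ i, HasCompactSupport (f i)) →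
    (∀ i j, i ≠ j → Disjoint (tsupport (f i : E4 → ℝ)) (tsupport (f j : E4 → ℝ))) →
      Tendsto (fun k : ℕ => latticeSchwinger r.ρ sch (fun s => s.F) k n (fun _ => r.curvature) f -
        doubledSchwinger r sch k n f) atTop (𝓝 0)

end Doubled

end Summit.QuantumFields.YangMills.Cruxes.DiagonalMirrorRPR.KmsVarianceLukewarmDescent

end
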